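import Literature.Probability.Percolation.ArmSeparationBeacon
import Literature.Probability.Percolation.ArmSeparationTubes
import HarnessLib

/-!
# Spokes: from a fenced inner tip to the ring road

Topic: Probability / Percolation; family `crit-perc`. A brick of the discharge of
`Literature.Probability.Percolation.Nolin2008_twoArm_separation` (Nolin 2008, Thm. 11
[arXiv 0711.4948: Thm. 10], `j = 2`, `σ = BW`; `ArmSeparation.lean`), landing step of the internal
extremities (Nolin 2008, Prop. 12 (iii)–(i) [arXiv Prop. 11]: RSW corridors glued by FKG). The
first corridor leaving a fenced inner tip is the **spoke**: in the tip's frame `i`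
(`frameIso i`, `ArmSeparationInnerFrames.lean`) it is the thin horizontal tube
`[c'₀ - L, c'₀ + k/4] × [c'₁ - ε, c'₁ + ε]` through the beacon centre `c'` (`ArmSeparationBeacon.lean`),
crossed horizontally; it ends inside the hexagonal ball `|v - c'| ≤ k/2` and starts outside
`|v - c'| ≥ 2k` (`L ≥ 2k`), so by `beacon_catch` its crossing is hooked to the arm. Read in the
original frame the spoke is an axis-parallel tube for `i ∈ {0, 2, 3, 5}` and a thin slanted strip
for `i ∈ {1, 4}`; in all cases it meets the crossing of any tube `E` of the original frame placed
across its far part like a plus sign (`SpokeMeets i`, six coordinate conditions), by the crossing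
lemma `exists_mem_of_cross`.

* `spokeTube m k T₀ w L ε`, `spokeEvent i …` (increasing, local, `P`-invariant: `real_spokeEvent`);
* `SpokeMeets i Sp E` — the junction condition, frame by frame;
* `arm_to_entry` — **the hook**: beacon + spoke + a crossing `(xE, yE)` of a tube `E` meeting the
  spoke ⟹ the far end `frameIso i Fo.b` of the fenced arm is joined to `xE` by an open path inside
  `frameIso i (spoke ∪ A ∪ tipBox) ∪ E`.

## References

* P. Nolin, *Near-critical percolation in two dimensions*, Electron. J. Probab. 13 (2008), §4.3
  Prop. 12, §4.4 [arXiv 0711.4948: Prop. 11, Thm. 10]. [Nolin2008]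
* H. Kesten, *Scaling relations for 2D-percolation*, Comm. Math. Phys. 109 (1987), Lemma 2. [Kesten1987]
-/

noncomputable section

open Set MeasureTheory

namespace Literature.Probability.Percolation

open LatticeModels HalfAnnulus Tube

/-! ### The spoke -/

/-- **The spoke** of a tip at scale `k` in the window `[T₀, T₀ + w)` (tip's frame): the tube
`[c'₀ - L, c'₀ + k/4] × [c'₁ - ε, c'₁ + ε]` through the beacon centre `c' = bcnCentre m k T₀ w`,
crossed horizontally. [cite: Nolin2008, §4.3 Prop. 12 (proof) (arXiv 0711.4948: Prop. 11)] -/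
def spokeTube (m k : ℕ) (T₀ : ℤ) (w L ε : ℕ) : Tube :=
  ⟨(bcnCentre m k T₀ w) 0 - L, (bcnCentre m k T₀ w) 1 - ε, L + k / 4, 2 * ε, true⟩

/-- **The spoke is crossed** (an event of the original configuration, read in the frame `i`). [cite: Nolin2008, §4.3 Prop. 12 (proof) (arXiv 0711.4948: Prop. 11)] -/
def spokeEvent (i m k : ℕ) (T₀ : ℤ) (w L ε : ℕ) : Set (SiteConfig (Site 2)) :=
  {χ | frameConfig i χ ∈ (spokeTube m k T₀ w L ε).event}

/-- Framing is monotone. [folklore] -/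
theorem frameConfig_mono (i : ℕ) {χ χ' : SiteConfig (Site 2)} (h : χ ≤ χ') : frameConfig i χ ≤ frameConfig i χ' :=
  fun v hv => by rw [mem_frameConfig] at hv ⊢; exact h hv

/-- Pulling an event back by a frame preserves monotonicity. [folklore] -/
theorem isUpperSet_preimage_frameConfig (i : ℕ) {E : Set (SiteConfig (Site 2))} (hE : IsUpperSet E) :
    IsUpperSet {χ | frameConfig i χ ∈ E} := fun _ _ hle h => hE (frameConfig_mono i hle) h

/-- Pulling an event back by a frame transports its support. [folklore] -/
theorem determinedBy_preimage_frameConfig (i : ℕ) {E : Set (SiteConfig (Site 2))} {B : Set (Site 2)} (hE : DeterminedBy E B) :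
    DeterminedBy {χ | frameConfig i χ ∈ E} (frameIso i '' B) := by
  rw [determinedBy_iff] at hE ⊢
  intro χ χ' h
  simp only [Set.mem_setOf_eq]
  apply hE
  ext v
  simp only [Set.mem_inter_iff, mem_frameConfig]
  constructor
  · rintro ⟨hv, hvB⟩
    have : frameIso i v ∈ χ ∩ frameIso i '' B := ⟨hv, v, hvB, rfl⟩
    rw [h] at this
    exact ⟨this.1, hvB⟩
  · rintro ⟨hv, hvB⟩
    have : frameIso i v ∈ χ' ∩ frameIso i '' B := ⟨hv, v, hvB, rfl⟩
    rw [← h] at this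
    exact ⟨this.1, hvB⟩

/-- The spoke event is increasing. [folklore] -/
theorem isUpperSet_spokeEvent (i m k : ℕ) (T₀ : ℤ) (w L ε : ℕ) : IsUpperSet (spokeEvent i m k T₀ w L ε) :=
  isUpperSet_preimage_frameConfig i (spokeTube m k T₀ w L ε).isUpperSet_event

/-- The spoke event is determined by the image of the spoke's box. [folklore] -/
theorem determinedBy_spokeEvent (i m k : ℕ) (T₀ : ℤ) (w L ε : ℕ) :
    DeterminedBy (spokeEvent i m k T₀ w L ε) (frameIso i '' (spokeTube m k T₀ w L ε).box) := by
  have h := determinedBy_preimage_frameConfig i (spokeTube m k T₀ w L ε).determinedBy_event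
  rwa [coe_sites] at h

/-- The probability of the spoke event is that of crossing the spoke tube. [folklore] -/
theorem real_spokeEvent (i m k : ℕ) (T₀ : ℤ) (w L ε : ℕ) :
    (triSitePercolation half).real (spokeEvent i m k T₀ w L ε) = (triSitePercolation half).real (spokeTube m k T₀ w L ε).event :=
  real_preimage_frameConfig half i _

/-! ### The junction condition -/

/-- **The spoke meets the tube `E` of the original frame** (frame by frame): read in the original
frame, the spoke of the frame `i` is the tube itself (`i = 0`), its transpose (`i = 2`), their
central reflections (`i = 3, 5`), or a thin slanted strip (`i = 1, 4`); the condition says that `E`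
lies across its far part like a plus sign. [cite: Nolin2008, §4.3 Prop. 12 (proof) (arXiv 0711.4948: Prop. 11)] -/
def SpokeMeets (i : ℕ) (Sp E : Tube) : Prop :=
  match i with
  | 0 => E.horiz = false ∧ Sp.a ≤ E.a ∧ E.a + E.w ≤ Sp.a + Sp.w ∧ E.b ≤ Sp.b ∧ Sp.b + Sp.h ≤ E.b + E.h
  | 1 => E.horiz = true ∧ E.a ≤ -(Sp.b + Sp.h) ∧ -Sp.b ≤ E.a + E.w ∧ Sp.a + Sp.b + Sp.h ≤ E.b ∧
      E.b + E.h ≤ Sp.a + Sp.w + Sp.b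
  | 2 => E.horiz = true ∧ E.a ≤ Sp.b ∧ Sp.b + Sp.h ≤ E.a + E.w ∧ Sp.a ≤ E.b ∧ E.b + E.h ≤ Sp.a + Sp.w
  | 3 => E.horiz = false ∧ -(Sp.a + Sp.w) ≤ E.a ∧ E.a + E.w ≤ -Sp.a ∧ E.b ≤ -(Sp.b + Sp.h) ∧ -Sp.b ≤ E.b + E.h
  | 4 => E.horiz = true ∧ E.a ≤ Sp.b ∧ Sp.b + Sp.h ≤ E.a + E.w ∧ -(Sp.a + Sp.w) - Sp.b ≤ E.b ∧
      E.b + E.h ≤ -Sp.a - Sp.b - Sp.h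
  | 5 => E.horiz = true ∧ E.a ≤ -(Sp.b + Sp.h) ∧ -Sp.b ≤ E.a + E.w ∧ -(Sp.a + Sp.w) ≤ E.b ∧ E.b + E.h ≤ -Sp.a
  | _ => False

/-! ### The hook -/

/-- **From the fenced arm to the entry tube.** Let `Fo` be a fenced arm of `frameConfig i χ`
(`i < 6`) in a region `A ⊇ HA(m)`, with scale `k ≥ 4` and tip row in the window `[T₀, T₀ + w)`
(`4w ≤ k`); suppose the beacon `triFrameAt c' (k/2)` and the spoke (`4ε ≤ k`, `2k ≤ L`) are realised,
and let `(xE, yE)` be a crossing in `χ` of a tube `E` of the original frame meeting the spoke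
(`SpokeMeets i`). Then the far end `frameIso i Fo.b` of the arm is joined to `xE` by an open path of
`χ` inside `frameIso i (spoke ∪ A ∪ tipBox) ∪ E`: the spoke's crossing ends in `|v - c'| ≤ k/2` and
starts in `|v - c'| ≥ 2k`, so it is hooked to the arm by `beacon_catch`, and read in the original
frame it meets the crossing of `E` (`exists_mem_of_cross`). [cite: Nolin2008, §4.3 Prop. 12 (proof) and §4.4 (arXiv 0711.4948: Prop. 11, Thm. 10)] -/
theorem arm_to_entry {m k₀ K R₀ : ℕ} {A : Set (Site 2)} (hHA : haSet m ⊆ A) {i : ℕ} (hi : i < 6) {χ : SiteConfig (Site 2)}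
    (Fo : IntFencedArm m A k₀ K R₀ (frameConfig i χ)) {T₀ : ℤ} {w : ℕ} (hwk : 4 * w ≤ Fo.k) (hk : 4 ≤ Fo.k)
    (hwin : T₀ ≤ Fo.z 1 ∧ Fo.z 1 < T₀ + w)
    (hB : frameConfig i χ ∈ triFrameAt (bcnCentre m Fo.k T₀ w) (Fo.k / 2))
    {L ε : ℕ} (hε : 4 * ε ≤ Fo.k) (hL : 2 * Fo.k ≤ L) (hSp : χ ∈ spokeEvent i m Fo.k T₀ w L ε)
    {E : Tube} {xE yE : Site 2} (hE : E.IsCrossing χ xE yE) (hJ : SpokeMeets i (spokeTube m Fo.k T₀ w L ε) E) :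
    PathIn triGraph ((frameIso i '' ((spokeTube m Fo.k T₀ w L ε).box ∪ (A ∪ tipBox m (Fo.z 1) Fo.k)) ∪ E.box) ∩ χ)
      (frameIso i Fo.b) xE := by
  have hk4 : 4 * ((Fo.k / 4 : ℕ) : ℤ) ≤ Fo.k ∧ (Fo.k : ℤ) ≤ 4 * ((Fo.k / 4 : ℕ) : ℤ) + 3 := by omega
  have hk2 : 2 * ((Fo.k / 2 : ℕ) : ℤ) ≤ Fo.k ∧ (Fo.k : ℤ) ≤ 2 * ((Fo.k / 2 : ℕ) : ℤ) + 1 := by omega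
  have hε' : 4 * (ε : ℤ) ≤ Fo.k := by exact_mod_cast hε
  have hL' : 2 * (Fo.k : ℤ) ≤ L := by exact_mod_cast hL
  obtain ⟨Sp, hSp'⟩ : ∃ Sp : Tube, Sp = spokeTube m Fo.k T₀ w L ε := ⟨_, rfl⟩
  obtain ⟨c', hc'⟩ : ∃ c' : Site 2, c' = bcnCentre m Fo.k T₀ w := ⟨_, rfl⟩
  have hSa : Sp.a = c' 0 - L := by rw [hSp', hc']; rfl
  have hSb : Sp.b = c' 1 - ε := by rw [hSp', hc']; rfl
  have hSw : Sp.w = L + Fo.k / 4 := by rw [hSp']; rfl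
  have hSh : Sp.h = 2 * ε := by rw [hSp']; rfl
  have hSp2 : frameConfig i χ ∈ Sp.event := by rw [hSp']; exact hSp
  rw [← hSp'] at hJ ⊢
  rw [← hc'] at hB
  -- (1) the crossing of the spoke in the tip's frame, read in the original frame, with a tight support
  obtain ⟨x', y', hs, P'⟩ := Sp.exists_isCrossing hSp2
  have hs' : x' 0 = Sp.a ∧ y' 0 = Sp.a + Sp.w := by rw [hSp'] at hs ⊢; exact hs
  have hx'b : x' ∈ Sp.box := P'.left_mem.1
  have hy'b : y' ∈ Sp.box := P'.right_mem.1
  rw [Tube.mem_box] at hx'b hy'b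
  have Pphys : PathIn triGraph ((frameIso i '' Sp.box) ∩ {v | v ∈ χ ↔ true}) (frameIso i x') (frameIso i y') :=
    pathIn_of_frameConfig i (P'.mono fun v hv => ⟨hv.1, by simpa using hv.2⟩)
  obtain ⟨S, hS, PS, TS⟩ := Pphys.exists_support
  have hSχ : S ⊆ χ := fun v hv => by simpa using (hS hv).2
  have star : ∀ u ∈ S, ∀ v ∈ S, PathIn triGraph S u v := fun u hu v hv => (TS u hu).symm.trans (TS v hv)
  -- (2) the beacon catches the end `frameIso i y'` of the spoke
  have hp : triNorm (frameIso i y' - frameIso i c') ≤ (Fo.k / 2 : ℕ) := by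
    rw [← frameIso_sub i hi, triNorm_frameIso i hi]
    refine triNorm_le_iff_lin.2 ?_
    simp only [Pi.sub_apply]
    omega
  have hq : 2 * (Fo.k : ℤ) ≤ triNorm (frameIso i x' - frameIso i c') := by
    rw [← frameIso_sub i hi, triNorm_frameIso i hi]
    refine le_triNorm_iff_lin.2 (Or.inr (Or.inl ?_))
    simp only [Pi.sub_apply]
    omega
  rw [hc'] at hB hp hq
  have hcatch := beacon_catch hHA hi Fo hwk hk hwin hB hSχ PS.symm (star _ PS.right_mem) hp hq
  -- (3) the spoke meets the crossing of `E`
  obtain ⟨SE, hSE, PE, TE⟩ := hE.2.exists_support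
  have physS : ∀ v ∈ S, ∃ u ∈ Sp.box, frameIso i u = v := fun v hv => by
    obtain ⟨⟨u, hu, huv⟩, -⟩ := hS hv; exact ⟨u, hu, huv⟩
  have hEbox : ∀ z ∈ SE, E.a ≤ z 0 ∧ z 0 ≤ E.a + E.w ∧ E.b ≤ z 1 ∧ z 1 ≤ E.b + E.h := fun z hz =>
    (Tube.mem_box E).1 (hSE hz).1
  have hE1 := hE.1
  have meet : ∃ z, z ∈ S ∧ z ∈ SE := by
    interval_cases i
    · -- frame 0: the spoke is horizontal, `E` vertical across its far part
      obtain ⟨hEh, h1, h2, h3, h4⟩ := hJ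
      rw [hEh] at hE1
      obtain ⟨hxE, hyE⟩ : xE 1 = E.b ∧ yE 1 = E.b + E.h := hE1
      obtain ⟨fx0, -⟩ := frameIso_apply_formula x'
      obtain ⟨fy0, -⟩ := frameIso_apply_formula y'
      refine exists_mem_of_cross (L := E.a) (R := E.a + E.w) (B := E.b) (T := E.b + E.h) (by omega) (by omega)
        PS (by rw [fx0]; omega) (by rw [fy0]; omega) (fun z hz _ _ => ?_) PE (by omega) (by omega)
        (fun z hz _ _ => ⟨(hEbox z hz).1, (hEbox z hz).2.1⟩)
      obtain ⟨u, hu, rfl⟩ := physS z hz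
      obtain ⟨g0, g1, -⟩ := frameIso_apply_formula u
      rw [Tube.mem_box] at hu; rw [g0, g1] at *; constructor <;> omega
    · -- frame 1 (`ρ`): the spoke is the slanted strip `x₀ ∈ [-(b+h), -b]`, `x₀ + x₁ ∈ [a, a+w]`; `E` horizontal
      obtain ⟨hEh, h1, h2, h3, h4⟩ := hJ
      rw [hEh] at hE1
      obtain ⟨hxE, hyE⟩ : xE 0 = E.a ∧ yE 0 = E.a + E.w := hE1
      obtain ⟨-, -, fx0, fx1, -⟩ := frameIso_apply_formula x'
      obtain ⟨-, -, fy0, fy1, -⟩ := frameIso_apply_formula y'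
      obtain ⟨z, hzE, hzS⟩ := exists_mem_of_cross (L := -(Sp.b + Sp.h)) (R := -Sp.b) (B := E.b) (T := E.b + E.h)
        (by omega) (by omega) PE (by omega) (by omega) (fun z hz _ _ => ⟨(hEbox z hz).2.2.1, (hEbox z hz).2.2.2⟩)
        PS (by rw [fx1]; omega) (by rw [fy1]; omega) (fun z hz _ _ => by
          obtain ⟨u, hu, rfl⟩ := physS z hz
          obtain ⟨-, -, g0, g1, -⟩ := frameIso_apply_formula u
          rw [Tube.mem_box] at hu; rw [g0]; constructor <;> omega)
      exact ⟨z, hzS, hzE⟩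
    · -- frame 2 (`σ`): the spoke is the vertical tube `[b, b+h] × [a, a+w]`; `E` horizontal
      obtain ⟨hEh, h1, h2, h3, h4⟩ := hJ
      rw [hEh] at hE1
      obtain ⟨hxE, hyE⟩ : xE 0 = E.a ∧ yE 0 = E.a + E.w := hE1
      obtain ⟨-, -, -, -, fx0, fx1, -⟩ := frameIso_apply_formula x'
      obtain ⟨-, -, -, -, fy0, fy1, -⟩ := frameIso_apply_formula y'
      obtain ⟨z, hzE, hzS⟩ := exists_mem_of_cross (L := Sp.b) (R := Sp.b + Sp.h) (B := E.b) (T := E.b + E.h)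
        (by omega) (by omega) PE (by omega) (by omega) (fun z hz _ _ => ⟨(hEbox z hz).2.2.1, (hEbox z hz).2.2.2⟩)
        PS (by rw [fx1]; omega) (by rw [fy1]; omega) (fun z hz _ _ => by
          obtain ⟨u, hu, rfl⟩ := physS z hz
          obtain ⟨-, -, -, -, g0, g1, -⟩ := frameIso_apply_formula u
          rw [Tube.mem_box] at hu; rw [g0]; constructor <;> omega)
      exact ⟨z, hzS, hzE⟩
    · -- frame 3 (`-id`): the spoke is the reflected horizontal tube; `E` vertical
      obtain ⟨hEh, h1, h2, h3, h4⟩ := hJ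
      rw [hEh] at hE1
      obtain ⟨hxE, hyE⟩ : xE 1 = E.b ∧ yE 1 = E.b + E.h := hE1
      obtain ⟨-, -, -, -, -, -, fx0, fx1, -⟩ := frameIso_apply_formula x'
      obtain ⟨-, -, -, -, -, -, fy0, fy1, -⟩ := frameIso_apply_formula y'
      refine exists_mem_of_cross (L := E.a) (R := E.a + E.w) (B := E.b) (T := E.b + E.h) (by omega) (by omega)
        PS.symm (by rw [fy0]; omega) (by rw [fx0]; omega) (fun z hz _ _ => ?_) PE (by omega) (by omega)
        (fun z hz _ _ => ⟨(hEbox z hz).1, (hEbox z hz).2.1⟩)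
      obtain ⟨u, hu, rfl⟩ := physS z hz
      obtain ⟨-, -, -, -, -, -, g0, g1, -⟩ := frameIso_apply_formula u
      rw [Tube.mem_box] at hu; rw [g1]; constructor <;> omega
    · -- frame 4 (`ρ⁴ = -ρ`): the spoke is the slanted strip `x₀ ∈ [b, b+h]`, `x₀ + x₁ ∈ [-(a+w), -a]`; `E` horizontal
      obtain ⟨hEh, h1, h2, h3, h4⟩ := hJ
      rw [hEh] at hE1
      obtain ⟨hxE, hyE⟩ : xE 0 = E.a ∧ yE 0 = E.a + E.w := hE1
      obtain ⟨-, -, -, -, -, -, -, -, fx0, fx1, -⟩ := frameIso_apply_formula x'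
      obtain ⟨-, -, -, -, -, -, -, -, fy0, fy1, -⟩ := frameIso_apply_formula y'
      obtain ⟨z, hzE, hzS⟩ := exists_mem_of_cross (L := Sp.b) (R := Sp.b + Sp.h) (B := E.b) (T := E.b + E.h)
        (by omega) (by omega) PE (by omega) (by omega) (fun z hz _ _ => ⟨(hEbox z hz).2.2.1, (hEbox z hz).2.2.2⟩)
        PS.symm (by rw [fy1]; omega) (by rw [fx1]; omega) (fun z hz _ _ => by
          obtain ⟨u, hu, rfl⟩ := physS z hz
          obtain ⟨-, -, -, -, -, -, -, -, g0, g1, -⟩ := frameIso_apply_formula u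
          rw [Tube.mem_box] at hu; rw [g0]; constructor <;> omega)
      exact ⟨z, hzS, hzE⟩
    · -- frame 5 (`-σ`): the spoke is the reflected vertical tube; `E` horizontal
      obtain ⟨hEh, h1, h2, h3, h4⟩ := hJ
      rw [hEh] at hE1
      obtain ⟨hxE, hyE⟩ : xE 0 = E.a ∧ yE 0 = E.a + E.w := hE1
      obtain ⟨-, -, -, -, -, -, -, -, -, -, fx0, fx1⟩ := frameIso_apply_formula x'
      obtain ⟨-, -, -, -, -, -, -, -, -, -, fy0, fy1⟩ := frameIso_apply_formula y'
      obtain ⟨z, hzE, hzS⟩ := exists_mem_of_cross (L := -(Sp.b + Sp.h)) (R := -Sp.b) (B := E.b) (T := E.b + E.h)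
        (by omega) (by omega) PE (by omega) (by omega) (fun z hz _ _ => ⟨(hEbox z hz).2.2.1, (hEbox z hz).2.2.2⟩)
        PS.symm (by rw [fy1]; omega) (by rw [fx1]; omega) (fun z hz _ _ => by
          obtain ⟨u, hu, rfl⟩ := physS z hz
          obtain ⟨-, -, -, -, -, -, -, -, -, -, g0, g1⟩ := frameIso_apply_formula u
          rw [Tube.mem_box] at hu; rw [g0]; constructor <;> omega)
      exact ⟨z, hzS, hzE⟩
  -- (4) assemble
  obtain ⟨z, hzS, hzE⟩ := meet
  have Q1 : PathIn triGraph ((frameIso i '' (Sp.box ∪ (A ∪ tipBox m (Fo.z 1) Fo.k)) ∪ E.box) ∩ χ) (frameIso i Fo.b) (frameIso i y') := by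
    refine hcatch.symm.mono ?_
    rintro v ⟨hv | ⟨u, hu, rfl⟩, hvχ⟩
    · obtain ⟨u, hu, rfl⟩ := physS v hv
      exact ⟨Or.inl ⟨u, Or.inl hu, rfl⟩, hvχ⟩
    · exact ⟨Or.inl ⟨u, Or.inr hu, rfl⟩, hvχ⟩
  have Q2 : PathIn triGraph ((frameIso i '' (Sp.box ∪ (A ∪ tipBox m (Fo.z 1) Fo.k)) ∪ E.box) ∩ χ) (frameIso i y') z := by
    refine (star _ PS.right_mem z hzS).mono fun v hv => ?_
    obtain ⟨u, hu, rfl⟩ := physS v hv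
    exact ⟨Or.inl ⟨u, Or.inl hu, rfl⟩, hSχ hv⟩
  have Q3 : PathIn triGraph ((frameIso i '' (Sp.box ∪ (A ∪ tipBox m (Fo.z 1) Fo.k)) ∪ E.box) ∩ χ) z xE :=
    (TE z hzE).symm.mono fun v hv => ⟨Or.inr (hSE hv).1, (hSE hv).2⟩
  exact (Q1.trans Q2).trans Q3

end Literature.Probability.Percolation
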